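import Summits.QuantumFields.BalabanUV.T4Continuum.Support.NE9PencilEndSharp
import Summits.QuantumFields.BalabanUV.T4Continuum.Support.NE9EndApplied

/-!
# NE9PencilEndSharpVacuum — ROUTE R3′'s SHARP END ON THE RECORD's OWN NEW-TERM SHAPE: with `Ψ = Re newTerm_U − Re newTerm_{U₀}
# + explZ` ([I] (2.13)–(2.14); `NE9EndApplied.ΨOf` by `rfl`) the explicit part CANCELS in table differences and the vacuum
# cluster sum is read at the same table, so the one-step Lipschitz constant is `2·B∕(R₀ − s₀)` (constant 1 per cluster sum, two
# cluster sums) — rate `ω + 2B·τ̄∕(R₀ − s₀)`; the companion of `NE9HoloFamilyVacuumSubtracted` (route R4 on the same shape: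
# budget `2B + p̄₀`), so the two co-lead routes are now comparable ON THE RECORD's SHAPE letter for letter

Cell `pub-balaban`, T4-DAG §6 NE9; BINDER row NE9 OWNER lineage `b2b-balaban-t4-ne9-p1` gen 60, CRUX PROVER NE9 (ruling e34b3e0c (2)),
filing for route R3′ «pencil ∕ potential-KPG» (co-lead of record with R4; PRICING-NE9 v7.0.1 §B′∕§C′).  HONEST FRAMING (T4-DAG PAGE 1).
Rung (B)+1 of the FINITE-VOLUME T⁴ programme — NOT infinite volume, NOT a mass gap, NOT Clay.  NE9 (`T4OutputRate.NE9` ∧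
`FadingMemory`) is a cell NEW ESTIMATE, NOT PRINTED in [I] = [Balaban1987RG1] (CMP **109**), [II] = [Balaban1988RG2Cluster] (CMP
**116**), NOT PROVED for Bałaban's E^{(j)}: the END below is «NE9 ⇐ the named binders» (potential-KPG on the radius `R₀` AT EVERY
BACKGROUND incl. the vacuum configuration `U₀` = (R-0)[scope] «[II] Lemma 3 (2.38) read over Lemma 2's box» + KP for `m`; `hdec`,
`hpin`, `hocc`, structural binders; the record's SHAPE `hΨv`); a sharper constant in a CONDITIONAL END is not progress on the
estimate itself; W1 = model O-NE9-1 untouched; spine 0∕9.  HONEST DEPENDENCY (cell line, verbatim): continuum YM on T⁴ ⇐ BetaPertH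
∧ nine spine estimates (0/9 proved); BetaPertH ⇐ (D1) ∧ (D4) ∧ CAP+tail; G-an2-4 gates asym, D1 and NE2/3/4.  `FlowStep.BetaPertH`,
(B), (B^μ) do not occur; [I]∕[II] for TYPES only.
CONTENT ([folklore]; 0 def, 0 sorry): §1 **`outputLipschitz_of_potentialKPG_sharp_vac`** (constant `2·B₀ k∕(R₀ − s₀)`; `explZ`
cancels — NO size letter for it is needed on this route), `outerLipschitz_of_potentialKPG_sharp_vac`,
**`ne9_and_fadingMemory_of_potentialKPG_perStep_sharp_vac`** (rate `ω + 2B·τ̄∕(R₀ − s₀)`), `fade_iff_room_sharp_vac` (fades iff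
`2B·τ̄ < (R₀ − s₀)(1 − ω)`); §2 **`ne9_and_fadingMemory_of_potentialKPG_psiOf`** (the END at `Ψ := NE9EndApplied.ΨOf G act wt U₀ explZ`
with the concrete reading `readingρ wt`, `hΨv` by `rfl`, `hρ` by `NE9TableReading`'s reading lemma supplied as a hypothesis-free
argument where available).  DISGUISE TEST: composition over `NE9PencilEndSharp`; nothing of Bałaban's asserted.
References (TYPES only): [Balaban1987RG1] CMP **109** (2.13)–(2.14) p. 268; [Balaban1988RG2Cluster] CMP **116** Lemma 3 (2.38)
p. 20, (2.40)–(2.41) p. 21, (1.36) p. 9; [KoteckyPreiss1986] p. 492–493.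
-/

noncomputable section

namespace Summit.QuantumFields.BalabanUV.T4Continuum.NE9PencilEndSharpVacuum

open Metric Set
open scoped BigOperators ENNReal
open Literature.Probability.LatticeModels
open Literature.MathematicalPhysics.QuantumFieldTheory.Balaban1983to89
open Literature.MathematicalPhysics.QuantumFieldTheory.Balaban1983to89.T4OutputRate
open Literature.MathematicalPhysics.QuantumFieldTheory.Balaban1983to89.T4ActivityLipschitz
open Literature.MathematicalPhysics.QuantumFieldTheory.Balaban1983to89.T4HistoryLipschitzRecursion
open Literature.MathematicalPhysics.QuantumFieldTheory.Balaban1983to89.T4HistoryLipschitzOuter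
open Literature.MathematicalPhysics.QuantumFieldTheory.Balaban1983to89.T4HistoryLipschitzActivity
open Literature.MathematicalPhysics.QuantumFieldTheory.Balaban1983to89.T4HistoryLipschitzActivity (ClusterGeom)
open Summit.QuantumFields.BalabanUV.T4Continuum.NE9PencilEndSharp

variable {C : Carriers} (G : ClusterGeom C) {Bg : Type} {Pot : Type*} [NormedAddCommGroup Pot] [NormedSpace ℂ Pot]

/-! ## §1 The sharp potential-KPG END on the vacuum-subtracted new-term shape -/

section Vac

/-- **`OutputLipschitz` FROM POTENTIAL-KPG ON THE RECORD's SHAPE, constant `2·B₀ k∕(R₀ − s₀)`**: with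
`Ψ k s P U X = Re newTerm_U (ρ k P) − Re newTerm_{U₀} (ρ k P) + explZ k U X` the explicit part cancels in the table difference and
each of the two cluster sums (at `U` and at the vacuum configuration `U₀`, both covered by `PotentialKPG`'s «every background»)
is Lipschitz with the SHARP constant `a(γ)e^{−δ}∕(R₀ − s₀)` of `NE9PencilEndSharp.norm_clusterSum_sub_le_of_ballKPG_sharp`.
[cite: Balaban1987RG1, (2.13)-(2.14) p.268; Balaban1988RG2Cluster, Lemma 3 (2.38) p.20 and (2.40)-(2.41) p.21] -/
theorem outputLipschitz_of_potentialKPG_sharp_vac {ι : Type} {E : Functional C Bg} {W : Set (ℕ → ℝ)}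
    {T : ℕ → (ℕ → ℝ) → (Bg → C.Dom → ℝ) → ι → ℝ} {Ψ : ℕ → ℝ → (ι → ℝ) → Bg → C.Dom → ℝ}
    {act : ℕ → ℝ → Bg → Pot → G.P → ℂ} {m : ℕ → ℝ → Bg → G.P → ℝ} {a d : G.P → ℝ} {δ : C.Dom → ℝ} {B₀ : ℕ → ℝ}
    {κ s₀ R₀ : ℝ} {wt : ℕ → ι → ℝ} {U₀ : Bg} {explZ : ℕ → Bg → C.Dom → ℝ} (ρ : ℕ → (ι → ℝ) → Pot)
    (hKP : G.PotentialKPG W act m a d R₀) (hdec : G.DecayExtract δ d) (hpin : G.PinBudget a δ B₀ κ) (hsR : s₀ < R₀)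
    (hρ : ∀ (k : ℕ) (P P' : ι → ℝ) (M : ℝ), (∀ y, |P y - P' y| ≤ wt k y * M) → ‖ρ k P - ρ k P'‖ ≤ M)
    (hΨv : ∀ (k : ℕ) (s : ℝ) (P : ι → ℝ) (U : Bg) (X : C.Dom),
      Ψ k s P U X = (G.newTerm act k s U X (ρ k P)).re - (G.newTerm act k s U₀ X (ρ k P)).re + explZ k U X)
    (hocc : ∀ g ∈ W, ∀ g' ∈ W, ∀ k : ℕ, ‖ρ k (T k g' (E g))‖ ≤ s₀) :
    OutputLipschitz E W T Ψ κ wt (fun k => 2 * B₀ k / (R₀ - s₀)) := by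
  obtain ⟨ha, hd, hP⟩ := hKP
  intro g hg g' hg' k M hM U X hX
  have hQQ' : ‖ρ k (T k g' (E g)) - ρ k (T k g' (E g'))‖ ≤ M := hρ k _ _ M hM
  have hϱ : 0 < R₀ - s₀ := sub_pos.mpr hsR
  have hM0 : 0 ≤ M := (norm_nonneg _).trans hQQ'
  -- one cluster sum at an arbitrary background `U'`: the sharp bound
  have key : ∀ U' : Bg, ‖G.newTerm act k (g' k) U' X (ρ k (T k g' (E g))) -
      G.newTerm act k (g' k) U' X (ρ k (T k g' (E g')))‖ ≤ Real.exp (-(κ * C.d X)) * (B₀ k / (R₀ - s₀) * M) := by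
    intro U'
    obtain ⟨hhol, hmaj, hkp⟩ := hP g' hg' k U' X hX
    have h1 := norm_clusterSum_sub_le_of_ballKPG_sharp (inc := G.inc) (w := fun Q => act k (g' k) U' Q) ha hd hsR hhol
      hmaj hkp (G.pin_mem X) (G.clus_sub X) (G.clus_pin X) (hdec X) (hocc g hg g' hg' k) (hocc g' hg' g' hg' k)
    have h4 : 0 ≤ (B₀ k * Real.exp (-(κ * C.d X))) / (R₀ - s₀) :=
      div_nonneg (le_trans (mul_nonneg (ha _) (Real.exp_nonneg _)) (hpin k X hX)) hϱ.le
    calc ‖G.newTerm act k (g' k) U' X (ρ k (T k g' (E g))) - G.newTerm act k (g' k) U' X (ρ k (T k g' (E g')))‖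
        ≤ (a (G.pin X) * Real.exp (-(δ X))) / (R₀ - s₀) * ‖ρ k (T k g' (E g)) - ρ k (T k g' (E g'))‖ := h1
      _ ≤ (B₀ k * Real.exp (-(κ * C.d X))) / (R₀ - s₀) * M :=
          mul_le_mul (div_le_div_of_nonneg_right (hpin k X hX) hϱ.le) hQQ' (norm_nonneg _) h4
      _ = Real.exp (-(κ * C.d X)) * (B₀ k / (R₀ - s₀) * M) := by ring
  rw [hΨv, hΨv]
  have hU := key U
  have hU₀ := key U₀
  calc |(G.newTerm act k (g' k) U X (ρ k (T k g' (E g)))).re - (G.newTerm act k (g' k) U₀ X (ρ k (T k g' (E g)))).re +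
          explZ k U X -
          ((G.newTerm act k (g' k) U X (ρ k (T k g' (E g')))).re -
            (G.newTerm act k (g' k) U₀ X (ρ k (T k g' (E g')))).re + explZ k U X)|
        = |(G.newTerm act k (g' k) U X (ρ k (T k g' (E g))) - G.newTerm act k (g' k) U X (ρ k (T k g' (E g')))).re -
            (G.newTerm act k (g' k) U₀ X (ρ k (T k g' (E g))) -
              G.newTerm act k (g' k) U₀ X (ρ k (T k g' (E g')))).re| := by
          rw [Complex.sub_re, Complex.sub_re]; ring_nf
    _ ≤ ‖G.newTerm act k (g' k) U X (ρ k (T k g' (E g))) - G.newTerm act k (g' k) U X (ρ k (T k g' (E g')))‖ +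
          ‖G.newTerm act k (g' k) U₀ X (ρ k (T k g' (E g))) - G.newTerm act k (g' k) U₀ X (ρ k (T k g' (E g')))‖ :=
          (abs_sub _ _).trans (add_le_add (Complex.abs_re_le_norm _) (Complex.abs_re_le_norm _))
    _ ≤ Real.exp (-(κ * C.d X)) * (B₀ k / (R₀ - s₀) * M) + Real.exp (-(κ * C.d X)) * (B₀ k / (R₀ - s₀) * M) :=
          add_le_add hU hU₀
    _ = Real.exp (-(κ * C.d X)) * (2 * B₀ k / (R₀ - s₀) * M) := by ring

/-- **`OuterLipschitz` FROM POTENTIAL-KPG ON THE RECORD's SHAPE**, constant `2·B₀ k∕(R₀ − s₀)` (factorisation + last-coupling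
moduli + §1's output Lipschitz bound). [cite: Balaban1988RG2Cluster, Lemma 3 (2.38) p.20 and (2.40)-(2.41) p.21] -/
theorem outerLipschitz_of_potentialKPG_sharp_vac {ι : Type} {E : Functional C Bg} {W : Set (ℕ → ℝ)}
    {T : ℕ → (ℕ → ℝ) → (Bg → C.Dom → ℝ) → ι → ℝ} {Ψ : ℕ → ℝ → (ι → ℝ) → Bg → C.Dom → ℝ}
    {act : ℕ → ℝ → Bg → Pot → G.P → ℂ} {m : ℕ → ℝ → Bg → G.P → ℝ} {a d : G.P → ℝ} {δ : C.Dom → ℝ} {B₀ lam : ℕ → ℝ}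
    {κ s₀ R₀ : ℝ} {wt : ℕ → ι → ℝ} {U₀ : Bg} {explZ : ℕ → Bg → C.Dom → ℝ} (ρ : ℕ → (ι → ℝ) → Pot)
    (hfac : Factorises E W T Ψ) (hlast : LastCouplingLipschitz E W T Ψ κ lam) (hKP : G.PotentialKPG W act m a d R₀)
    (hdec : G.DecayExtract δ d) (hpin : G.PinBudget a δ B₀ κ) (hsR : s₀ < R₀)
    (hρ : ∀ (k : ℕ) (P P' : ι → ℝ) (M : ℝ), (∀ y, |P y - P' y| ≤ wt k y * M) → ‖ρ k P - ρ k P'‖ ≤ M)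
    (hΨv : ∀ (k : ℕ) (s : ℝ) (P : ι → ℝ) (U : Bg) (X : C.Dom),
      Ψ k s P U X = (G.newTerm act k s U X (ρ k P)).re - (G.newTerm act k s U₀ X (ρ k P)).re + explZ k U X)
    (hocc : ∀ g ∈ W, ∀ g' ∈ W, ∀ k : ℕ, ‖ρ k (T k g' (E g))‖ ≤ s₀) :
    OuterLipschitz E W T κ wt lam (fun k => 2 * B₀ k / (R₀ - s₀)) :=
  outerLipschitz_of_factorisation hfac hlast
    (outputLipschitz_of_potentialKPG_sharp_vac G ρ hKP hdec hpin hsR hρ hΨv hocc)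

/-- **ROUTE R3′'s SHARP END ON THE RECORD's SHAPE**: the binder list of `NE9PencilEndSharp.ne9_and_fadingMemory_of_potentialKPG_perStep_sharp`
with `hΨ` REPLACED by the record's shape `hΨv` (vacuum-subtracted + explicit part) and `hpos` re-lettered ⊢ NE9 with the product
moduli of rate `ω + 2B·τ̄∕(R₀ − s₀)` and `FadingMemory` of the same rate.  «NE9 ⇐ the named binders»; compare route R4 on the
same shape (`NE9HoloFamilyVacuumSubtracted.ne9_and_fadingMemory_of_pencil_EH_vac_star`: slice budget `2B + p̄₀`, rate
`2θ∕(1+θ)` under the room `ω̂·s₀ + τ̄·(2B + p̄₀) ≤ θ·s₀`) — here the explicit part costs NOTHING (it cancels).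
[cite: Balaban1987RG1, (2.13)-(2.14) p.268; Balaban1988RG2Cluster, Lemma 3 (2.38) p.20, (2.40)-(2.41) p.21 and (1.36) p.9] -/
theorem ne9_and_fadingMemory_of_potentialKPG_perStep_sharp_vac {ι : Type} {E : Functional C Bg} {W : Set (ℕ → ℝ)}
    {Adm : Set (Bg → C.Dom → ℝ)} {T : ℕ → (ℕ → ℝ) → (Bg → C.Dom → ℝ) → ι → ℝ}
    {Ψ : ℕ → ℝ → (ι → ℝ) → Bg → C.Dom → ℝ} {act : ℕ → ℝ → Bg → Pot → G.P → ℂ} {m : ℕ → ℝ → Bg → G.P → ℝ}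
    {a d : G.P → ℝ} {δ : C.Dom → ℝ} {κ s₀ R₀ B ℓ τbar ω : ℝ} {wt : ℕ → ι → ℝ} {τ : ℕ → ℕ → ℝ} {lam : ℕ → ℝ}
    {U₀ : Bg} {explZ : ℕ → Bg → C.Dom → ℝ}
    (ρ : ℕ → (ι → ℝ) → Pot) (h0 : ScaleZeroFree E W) (hAdm : AdmissibleTerms E W Adm) (hres : AdmRestrict Adm)
    (hadd : ChannelAdditive Adm T) (hsum : ChannelStepSum Adm T) (hstep : ChannelSizeAtStepNN Adm T κ wt τ)
    (hfac : Factorises E W T Ψ) (hlast : LastCouplingLipschitz E W T Ψ κ lam) (hKP : G.PotentialKPG W act m a d R₀)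
    (hdec : G.DecayExtract δ d) (hpin : G.PinBudget a δ (fun _ => B) κ) (hsR : s₀ < R₀)
    (hρ : ∀ (k : ℕ) (P P' : ι → ℝ) (M : ℝ), (∀ y, |P y - P' y| ≤ wt k y * M) → ‖ρ k P - ρ k P'‖ ≤ M)
    (hΨv : ∀ (k : ℕ) (s : ℝ) (P : ι → ℝ) (U : Bg) (X : C.Dom),
      Ψ k s P U X = (G.newTerm act k s U X (ρ k P)).re - (G.newTerm act k s U₀ X (ρ k P)).re + explZ k U X)
    (hocc : ∀ g ∈ W, ∀ g' ∈ W, ∀ k : ℕ, ‖ρ k (T k g' (E g))‖ ≤ s₀) (hℓ : 0 ≤ ℓ) (hB : 0 ≤ B) (hτbar : 0 ≤ τbar)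
    (hω : 0 ≤ ω) (hpos : 0 < ω + 2 * B / (R₀ - s₀) * τbar) (hlam : ∀ k, lam k ≤ ℓ)
    (hτ : ∀ k j, j ≤ k → 0 ≤ τ k j ∧ τ k j ≤ τbar * ω ^ (k - j)) :
    NE9 E W κ (prodModuli ℓ fun _ => ω + 2 * B / (R₀ - s₀) * τbar) ∧
      FadingMemory (ℓ / (ω + 2 * B / (R₀ - s₀) * τbar)) (ω + 2 * B / (R₀ - s₀) * τbar)
        (prodModuli ℓ fun _ => ω + 2 * B / (R₀ - s₀) * τbar) :=
  have hc : 0 ≤ 2 * B / (R₀ - s₀) := div_nonneg (by positivity) (sub_pos.mpr hsR).le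
  ne9_and_fadingMemory_of_perStepNN h0 hAdm hres hadd hsum hstep
    (outerLipschitz_of_potentialKPG_sharp_vac G ρ hfac hlast hKP hdec hpin hsR hρ hΨv hocc) hℓ hc hτbar hω hpos hlam
    (fun _ => ⟨hc, le_rfl⟩) hτ

omit G in
/-- [folklore] The record-shape sharp rate fades iff `2B·τ̄ < (R₀ − s₀)(1 − ω)` (`NE9PencilEndSharp.fade_iff_room_sharp` at `2B`). -/
theorem fade_iff_room_sharp_vac {ω B τbar R₀ s₀ : ℝ} (hsR : s₀ < R₀) :
    ω + 2 * B / (R₀ - s₀) * τbar < 1 ↔ 2 * B * τbar < (R₀ - s₀) * (1 - ω) :=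
  fade_iff_room_sharp (B := 2 * B) hsR

end Vac

/-! ## §2 Junction with the record: the END at `Ψ := NE9EndApplied.ΨOf` -/

section Record

open Summit.QuantumFields.BalabanUV.T4Continuum.NE9EndApplied
open Summit.QuantumFields.BalabanUV.T4Continuum.NE9TableReading
open Summit.QuantumFields.BalabanUV.T4Continuum.NE9ComplexEncoding (doubleCarriers)

variable {C₀ : Carriers} {E : Type} {ι : Type}

omit G in
/-- **ROUTE R3′'s SHARP END AT THE RECORD's OWN NEW-TERM MAP `ΨOf`** (reading `readingρ wt`): §1's END at
`Ψ := NE9EndApplied.ΨOf G act wt U₀ explZ`, `hΨv` discharged by `rfl`; the reading's 1-Lipschitz property in the weighted sup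
distance is kept DISPLAYED as `hρ` (the tree's `NE9EndApplied`∕`NE9TableReading` discharge it for positive weights — consumers
pass that lemma).  For ANY functional on the re∕im-doubled carriers factorising through a channel with this new-term map (e.g.
`EfOf` via `factorises_EfOf`) ⊢ NE9 ∧ FadingMemory at rate `ω + 2B·τ̄∕(R₀ − s₀)`.  «NE9 ⇐ the named binders».
[cite: Balaban1987RG1, (2.13)-(2.14) p.268 and (0.23) p.256; Balaban1988RG2Cluster, Lemma 3 (2.38) p.20, (2.40)-(2.41) p.21 and (1.36) p.9] -/
theorem ne9_and_fadingMemory_of_potentialKPG_psiOf (G : ClusterGeom (doubleCarriers C₀))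
    {Ef : Functional (doubleCarriers C₀) E} {W : Set (ℕ → ℝ)} {Adm : Set (E → (doubleCarriers C₀).Dom → ℝ)}
    {T : ℕ → (ℕ → ℝ) → (E → (doubleCarriers C₀).Dom → ℝ) → ι → ℝ} {κ s₀ R₀ B ℓ τbar ω : ℝ} {wt : ℕ → ι → ℝ}
    {τ : ℕ → ℕ → ℝ} {lam : ℕ → ℝ} {act : ℕ → ℝ → E → lp (fun _ : ι => ℂ) ∞ → G.P → ℂ} {m : ℕ → ℝ → E → G.P → ℝ}
    {a d : G.P → ℝ} {δ : (doubleCarriers C₀).Dom → ℝ} {U₀ : E} {explZ : ℕ → E → (doubleCarriers C₀).Dom → ℝ}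
    (h0 : ScaleZeroFree Ef W) (hAdm : AdmissibleTerms Ef W Adm) (hres : AdmRestrict Adm)
    (hadd : ChannelAdditive Adm T) (hsum : ChannelStepSum Adm T) (hstep : ChannelSizeAtStepNN Adm T κ wt τ)
    (hfac : Factorises Ef W T (ΨOf G act wt U₀ explZ))
    (hlast : LastCouplingLipschitz Ef W T (ΨOf G act wt U₀ explZ) κ lam) (hKP : G.PotentialKPG W act m a d R₀)
    (hdec : G.DecayExtract δ d) (hpin : G.PinBudget a δ (fun _ => B) κ) (hsR : s₀ < R₀)
    (hρ : ∀ (k : ℕ) (P P' : ι → ℝ) (M : ℝ), (∀ y, |P y - P' y| ≤ wt k y * M) →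
      ‖readingρ wt k P - readingρ wt k P'‖ ≤ M)
    (hocc : ∀ g ∈ W, ∀ g' ∈ W, ∀ k : ℕ, ‖readingρ wt k (T k g' (Ef g))‖ ≤ s₀) (hℓ : 0 ≤ ℓ) (hB : 0 ≤ B)
    (hτbar : 0 ≤ τbar) (hω : 0 ≤ ω) (hpos : 0 < ω + 2 * B / (R₀ - s₀) * τbar) (hlam : ∀ k, lam k ≤ ℓ)
    (hτ : ∀ k j, j ≤ k → 0 ≤ τ k j ∧ τ k j ≤ τbar * ω ^ (k - j)) :
    NE9 Ef W κ (prodModuli ℓ fun _ => ω + 2 * B / (R₀ - s₀) * τbar) ∧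
      FadingMemory (ℓ / (ω + 2 * B / (R₀ - s₀) * τbar)) (ω + 2 * B / (R₀ - s₀) * τbar)
        (prodModuli ℓ fun _ => ω + 2 * B / (R₀ - s₀) * τbar) :=
  ne9_and_fadingMemory_of_potentialKPG_perStep_sharp_vac G (readingρ wt) h0 hAdm hres hadd hsum hstep hfac hlast hKP hdec
    hpin hsR hρ (fun _ _ _ _ _ => rfl) hocc hℓ hB hτbar hω hpos hlam hτ

end Record

end Summit.QuantumFields.BalabanUV.T4Continuum.NE9PencilEndSharpVacuum

end
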